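import Summits.ABC.ABC.Theorems.CongruentialReceptacleTameLocalReceptacleEngineCellsDefs
import Summits.ABC.ABC.Theorems.CongruentialReceptacleTameLocalReceptacleStubCardFABonferroni
import Summits.ABC.ABC.Theorems.CongruentialReceptacleTameLocalReceptacleStubCardFCBonferroni
import Literature.NumberTheory.Sieve.SmoothProfileMinor
import Literature.NumberTheory.Sieve.SmoothPolylogRegimeScales

/-!
# Crux `CongruentialReceptacle.TameLocalReceptacle` (stmt-ABC-14354), line `grh-friable-cell-resolution`:
# `FamilySize` from the sieved lower bounds (family bookkeeping)

Helper of the checked skeleton `Cruxes/TameLocalReceptacle/Lines/grh_friable_cell_resolution.lean`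
(lead `prover-line-stmt-ABC-14354-a1-0`, wave 8), consumed by `stub_familySize`.  The analytic input — the
SIEVED LOWER BOUND for the parity ternary counts `W = parityTernarySum y σ d₁ 1 (x/e₁) (x/e₂) (x/e₃) c₁ c₂ c₃`
at the master scale `x` with `y = ⌊(log x)^{100000}⌋₊`,
`c₀ · Mv₁ Mv₂ Mv₃ / (x/e₃) ≤ Re W − Σ_{3 ≤ p ≤ y prime} Re W_p`, `Mv_i = e_i^{−α} 𝓜`,
`𝓜 = x^α ζ(α,y)/√(2π φ₂(α,y))`, `α = α(x, y)` — is taken as the two EXPLICIT HYPOTHESES `hA` (sign `σ = 1`,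
the three scale configurations of `FA`, `G`, `G'`) and `hC` (sign `σ = −1`, the configuration of `FC`); this file
does the family bookkeeping turning them into `FamilySize`:

* at `x = masterScale N M = 48 · 2^N · M` (so `(48 · 2^N · M : ℕ)` cast to `ℝ` is `masterScale N M` and
  `⌊(log x)^{100000}⌋₊ = levelOf N M` definitionally) the four configurations have exactly the scales of the
  Bonferroni bounds `stub_cardFA_ge_bonferroni` (for `FAfam N M y`, `famG = FAfam 1 (2^{N−1} M) y`,
  `famG' = FAfam 1 M y`) and `stub_cardFC_ge_bonferroni` (`FCfam N M y`): `x/(24·2^N) = 2M`, `x/24 = 2·2^N M`,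
  `x/12 = 4·2^N M`, `x/48 = 2·(2^{N−1} M)`, `x/(12·2^N) = 4M = 2·(2M)`, `x/(6·2^N) = 4·(2M)`; `#famFB = #famFA`
  (`card_FBfam`);
* the regime facts at real `x → ∞` (`FamilySizeBook.regime_eventually`, from `polylog_regime_basic`,
  `saddlePoint_lt_one` and `card_smoothNumbersUpTo_le_three_mul_saddleSize`): `α < 1`, `𝓜 ≥ 0` and
  `Ψ(x, y) ≤ 3 x^α ζ/√φ₂ = 3 √(2π) 𝓜 ≤ 9 𝓜`;
* real arithmetic (`FamilySizeBook.card_ge_of_main`): `Mv_i ≥ 𝓜/e_i` (`e_i ≥ 1`, `α ≤ 1`), so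
  `c₀ ΠMv/(x/e₃) ≥ c₀ 𝓜³/(e₁ e₂ x) ≥ c₀ Ψ³/(729 e₁ e₂ x)`, and `729 e₁ e₂ ≤ 10⁶ · 4^N` in all four
  configurations: `c := min c₀(A) c₀(C) / (10⁶ · 2^N · 2^N)`.
-/

-- `Summit.<Summit>.<Problem>` is the mandated summit-side namespace (CONVENTIONS §2); for the
-- single-conjunct summit `ABC` the two coincide, so the duplicate `ABC.ABC` is deliberate.
set_option linter.dupNamespace false

noncomputable section

namespace Summit.ABC.ABC.Theorems.TameLocalReceptacle

open Finset Filter Literature.NumberTheory.Sieve Literature.NumberTheory.Sieve.SmoothArcs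

namespace FamilySizeBook

/-! ### Real arithmetic -/

/-- `Ψ ≤ 3 · A ζ/√φ` implies `Ψ ≤ 9 · A ζ/√(2π φ)` (`√(2π) ≤ 3`; both sides vanish when `√φ = 0`). [folklore] -/
theorem psi_le_nine_mul {Ψ A ζ φ : ℝ} (hA : 0 ≤ A) (hζ : 0 ≤ ζ) (h : Ψ ≤ 3 * (A * (ζ / Real.sqrt φ))) :
    Ψ ≤ 9 * (A * ζ / Real.sqrt (2 * Real.pi * φ)) := by
  have hsq : Real.sqrt (2 * Real.pi) ≤ 3 := by
    rw [Real.sqrt_le_left (by norm_num)]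
    nlinarith [Real.pi_le_four]
  rw [Real.sqrt_mul (by positivity) φ]
  rcases (Real.sqrt_nonneg φ).eq_or_lt with h0 | hpos
  · rw [← h0] at h ⊢
    simp only [div_zero, mul_zero] at h ⊢
    exact h
  · have hsp : 0 < Real.sqrt (2 * Real.pi) := Real.sqrt_pos.2 (by positivity)
    calc Ψ ≤ 3 * (A * (ζ / Real.sqrt φ)) := h
      _ = 9 * (A * ζ / (3 * Real.sqrt φ)) := by
        field_simp
        ring
      _ ≤ 9 * (A * ζ / (Real.sqrt (2 * Real.pi) * Real.sqrt φ)) := by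
        refine mul_le_mul_of_nonneg_left ?_ (by norm_num)
        exact div_le_div_of_nonneg_left (mul_nonneg hA hζ) (mul_pos hsp hpos)
          (mul_le_mul_of_nonneg_right hsq hpos.le)

/-- From `c₀ · ΠMv / X₃ ≤ B`, `X₃ = x/e₃`, `Mv_i = e_i^{−α} K ≥ K/e_i` (`e_i ≥ 1`, `α ≤ 1`, `K ≥ 0`),
`Ψ ≤ 9K`, `m ≤ c₀` and `729 e₁ e₂ ≤ P`: `(m/P) · Ψ³/x ≤ B`. [folklore] -/
theorem card_ge_of_main {x K Ψ α c₀ m P e₁ e₂ e₃ X₃ B : ℝ} (hx : 0 < x) (hK : 0 ≤ K) (hΨ0 : 0 ≤ Ψ)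
    (hΨ : Ψ ≤ 9 * K) (hα : α < 1) (he₁ : 1 ≤ e₁) (he₂ : 1 ≤ e₂) (he₃ : 1 ≤ e₃) (hm0 : 0 ≤ m)
    (hm : m ≤ c₀) (hP : 729 * (e₁ * e₂) ≤ P) (hX : X₃ = x / e₃)
    (h : c₀ * (e₁ ^ (-α) * K * (e₂ ^ (-α) * K) * (e₃ ^ (-α) * K)) / X₃ ≤ B) :
    m / P * Ψ ^ 3 / x ≤ B := by
  subst hX
  have hc₀ : 0 ≤ c₀ := hm0.trans hm
  have hP0 : 0 < P := lt_of_lt_of_le (by positivity) hP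
  have hpow : ∀ e : ℝ, 1 ≤ e → e⁻¹ * K ≤ e ^ (-α) * K := fun e he => by
    refine mul_le_mul_of_nonneg_right ?_ hK
    rw [← Real.rpow_neg_one]
    exact Real.rpow_le_rpow_of_exponent_le he (by linarith)
  have hx3 : 0 < x / e₃ := div_pos hx (by linarith)
  have i₁ : 0 ≤ e₁⁻¹ * K := mul_nonneg (inv_nonneg.2 (by linarith)) hK
  have i₂ : 0 ≤ e₂⁻¹ * K := mul_nonneg (inv_nonneg.2 (by linarith)) hK
  have i₃ : 0 ≤ e₃⁻¹ * K := mul_nonneg (inv_nonneg.2 (by linarith)) hK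
  have h12 : e₁⁻¹ * K * (e₂⁻¹ * K) ≤ e₁ ^ (-α) * K * (e₂ ^ (-α) * K) :=
    mul_le_mul (hpow e₁ he₁) (hpow e₂ he₂) i₂ (i₁.trans (hpow e₁ he₁))
  have h1 : c₀ * (e₁⁻¹ * K * (e₂⁻¹ * K) * (e₃⁻¹ * K)) / (x / e₃) ≤ B := by
    refine le_trans (div_le_div_of_nonneg_right (mul_le_mul_of_nonneg_left ?_ hc₀) hx3.le) h
    exact mul_le_mul h12 (hpow e₃ he₃) i₃ ((mul_nonneg i₁ i₂).trans h12)
  have h2 : c₀ * (e₁⁻¹ * K * (e₂⁻¹ * K) * (e₃⁻¹ * K)) / (x / e₃) = c₀ * (K ^ 3 / (e₁ * e₂)) / x := by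
    field_simp
  have h3 : Ψ ^ 3 ≤ 729 * K ^ 3 := by
    calc Ψ ^ 3 ≤ (9 * K) ^ 3 := pow_le_pow_left₀ hΨ0 hΨ 3
      _ = 729 * K ^ 3 := by ring
  have hK3 : 0 ≤ K ^ 3 / (e₁ * e₂) := div_nonneg (pow_nonneg hK 3) (by nlinarith)
  have hmP : 0 ≤ m / P := div_nonneg hm0 hP0.le
  have hcoef : m / P * 729 ≤ c₀ / (e₁ * e₂) := by
    rw [div_mul_eq_mul_div, div_le_div_iff₀ hP0 (by nlinarith)]
    calc m * 729 * (e₁ * e₂) = m * (729 * (e₁ * e₂)) := by ring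
      _ ≤ c₀ * P := mul_le_mul hm hP (by nlinarith) hc₀
  calc m / P * Ψ ^ 3 / x ≤ m / P * (729 * K ^ 3) / x :=
        div_le_div_of_nonneg_right (mul_le_mul_of_nonneg_left h3 hmP) hx.le
    _ = m / P * 729 * (e₁ * e₂) * (K ^ 3 / (e₁ * e₂)) / x := by
        field_simp
    _ ≤ c₀ / (e₁ * e₂) * (e₁ * e₂) * (K ^ 3 / (e₁ * e₂)) / x := by
        refine div_le_div_of_nonneg_right (mul_le_mul_of_nonneg_right ?_ hK3) hx.le
        exact mul_le_mul_of_nonneg_right hcoef (by nlinarith)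
    _ = c₀ * (K ^ 3 / (e₁ * e₂)) / x := by
        rw [div_mul_cancel₀ _ (by nlinarith)]
    _ ≤ B := h2 ▸ h1

/-! ### The regime at the master scale -/

/-- For all large real `x`, with `y = ⌊(log x)^{100000}⌋₊`, `α = α(x, y)`,
`𝓜 = x^α ζ(α, y)/√(2π φ₂(α, y))`: `x > 1`, `y ≥ 2`, `α < 1`, `𝓜 ≥ 0` and `Ψ(x, y) ≤ 9 𝓜`
(`polylog_regime_basic`, `saddlePoint_lt_one`, `card_smoothNumbersUpTo_le_three_mul_saddleSize`). [folklore] -/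
theorem regime_eventually :
    ∀ᶠ x : ℝ in atTop, 1 < x ∧ 2 ≤ ⌊Real.log x ^ 100000⌋₊ ∧
      saddlePoint x ⌊Real.log x ^ 100000⌋₊ < 1 ∧
      0 ≤ x ^ saddlePoint x ⌊Real.log x ^ 100000⌋₊ *
          smoothZeta (saddlePoint x ⌊Real.log x ^ 100000⌋₊) ⌊Real.log x ^ 100000⌋₊ /
          Real.sqrt (2 * Real.pi * saddlePhi₂ (saddlePoint x ⌊Real.log x ^ 100000⌋₊) ⌊Real.log x ^ 100000⌋₊) ∧
      ((Nat.smoothNumbersUpTo ⌊x⌋₊ (⌊Real.log x ^ 100000⌋₊ + 1)).card : ℝ) ≤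
        9 * (x ^ saddlePoint x ⌊Real.log x ^ 100000⌋₊ *
          smoothZeta (saddlePoint x ⌊Real.log x ^ 100000⌋₊) ⌊Real.log x ^ 100000⌋₊ /
          Real.sqrt (2 * Real.pi * saddlePhi₂ (saddlePoint x ⌊Real.log x ^ 100000⌋₊) ⌊Real.log x ^ 100000⌋₊)) := by
  obtain ⟨xa, ha⟩ := card_smoothNumbersUpTo_le_three_mul_saddleSize
  obtain ⟨xb, hb⟩ := saddlePoint_lt_one
  filter_upwards [polylog_regime_basic, eventually_ge_atTop xa, eventually_ge_atTop xb] with x h hxa hxb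
  obtain ⟨hx1, hL2, hy2, -, -, hy4, hy8, hlog, -, h200, hhalf⟩ := h
  set Y : ℕ := ⌊Real.log x ^ 100000⌋₊ with hY
  clear_value Y
  clear hY
  have hL1 : 1 ≤ Real.log x := by linarith
  have hα0 : 0 < saddlePoint x Y := saddlePoint_pos hx1 hy2
  have hζ : 0 ≤ smoothZeta (saddlePoint x Y) Y := (smoothZeta_pos hα0).le
  have hxα : 0 ≤ x ^ saddlePoint x Y := Real.rpow_nonneg (by linarith) _
  have hy3 : Real.log x ^ 3 ≤ Y := (pow_le_pow_right₀ hL1 (by norm_num)).trans hy4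
  have hyx : (Y : ℝ) ≤ x := by
    have hy1 : (1 : ℝ) ≤ Y := by exact_mod_cast (by omega : 1 ≤ Y)
    exact ((le_self_pow₀ hy1 (by norm_num)).trans h200).trans hhalf
  have hlog' : Real.log Y ≤ Real.log x ^ (1 / 6 : ℝ) := by
    have : 0 ≤ Real.log x ^ (1 / 6 : ℝ) := by positivity
    linarith
  exact ⟨hx1, hy2, hb x Y hxb hy3 hyx hlog', div_nonneg (mul_nonneg hxα hζ) (Real.sqrt_nonneg _),
    psi_le_nine_mul hxα hζ (ha x Y hxa hy8 hlog x le_rfl)⟩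

end FamilySizeBook

open FamilySizeBook

/-- **`FamilySize` from the sieved lower bounds.**  If the sieved parity ternary counts at the master scale
`x → ∞` (`x : ℕ`, `y = ⌊(log x)^{100000}⌋₊`, `α = α(x,y)`, `Mv_i = e_i^{−α} · x^α ζ(α,y)/√(2π φ₂(α,y))`) dominate
`c₀ · Mv₁Mv₂Mv₃/(x/e₃)` in the three `σ = 1` configurations `(e₁,e₂,e₃,d₁) = (24·2^N, 24, 12, 2^N)`,
`(48, 24, 12, 2)`, `(24·2^N, 12·2^N, 6·2^N, 2)` (`hA`) and in the `σ = −1` configuration `(12·2^N, 24, 12, 2^N)`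
(`hC`), then every one of the five witness families has `≥ c · Ψ(x,y)³/x` members (`FamilySize`), with
`c = min c₀(A) c₀(C) / (10⁶ · 2^N · 2^N)`. [folklore] -/
theorem familySize_of_sieved
    (hA : ∃ (c₁ c₂ c₃ : ℤ → ℂ) (c₀ : ℝ), 0 < c₀ ∧
        (∀ v : ℝ, (profileFn c₁ v).im = 0 ∧ 0 ≤ (profileFn c₁ v).re ∧ (profileFn c₁ v).re ≤ (if v ∈ Set.Ioc (1 / 2 : ℝ) 1 then 1 else 0)) ∧
        (∀ v : ℝ, (profileFn c₂ v).im = 0 ∧ 0 ≤ (profileFn c₂ v).re ∧ (profileFn c₂ v).re ≤ (if v ∈ Set.Ioc (1 / 2 : ℝ) 1 then 1 else 0)) ∧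
        (∀ v : ℝ, (profileFn c₃ v).im = 0 ∧ 0 ≤ (profileFn c₃ v).re ∧ (profileFn c₃ v).re ≤ 1) ∧
        ∀ N : ℕ, 1 ≤ N → ∀ᶠ x : ℕ in Filter.atTop, ∀ (e₁ e₂ e₃ d₁ : ℕ),
          ((e₁ = 24 * 2 ^ N ∧ e₂ = 24 ∧ e₃ = 12 ∧ d₁ = 2 ^ N) ∨ (e₁ = 48 ∧ e₂ = 24 ∧ e₃ = 12 ∧ d₁ = 2) ∨
            (e₁ = 24 * 2 ^ N ∧ e₂ = 12 * 2 ^ N ∧ e₃ = 6 * 2 ^ N ∧ d₁ = 2)) →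
          c₀ * (((e₁ : ℝ) ^ (-saddlePoint (x : ℝ) ⌊Real.log (x : ℝ) ^ 100000⌋₊) *
            ((x : ℝ) ^ saddlePoint (x : ℝ) ⌊Real.log (x : ℝ) ^ 100000⌋₊ * smoothZeta (saddlePoint (x : ℝ) ⌊Real.log (x : ℝ) ^ 100000⌋₊) ⌊Real.log (x : ℝ) ^ 100000⌋₊ /
              Real.sqrt (2 * Real.pi * saddlePhi₂ (saddlePoint (x : ℝ) ⌊Real.log (x : ℝ) ^ 100000⌋₊) ⌊Real.log (x : ℝ) ^ 100000⌋₊))) *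
            ((e₂ : ℝ) ^ (-saddlePoint (x : ℝ) ⌊Real.log (x : ℝ) ^ 100000⌋₊) *
            ((x : ℝ) ^ saddlePoint (x : ℝ) ⌊Real.log (x : ℝ) ^ 100000⌋₊ * smoothZeta (saddlePoint (x : ℝ) ⌊Real.log (x : ℝ) ^ 100000⌋₊) ⌊Real.log (x : ℝ) ^ 100000⌋₊ /
              Real.sqrt (2 * Real.pi * saddlePhi₂ (saddlePoint (x : ℝ) ⌊Real.log (x : ℝ) ^ 100000⌋₊) ⌊Real.log (x : ℝ) ^ 100000⌋₊))) *
            ((e₃ : ℝ) ^ (-saddlePoint (x : ℝ) ⌊Real.log (x : ℝ) ^ 100000⌋₊) *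
            ((x : ℝ) ^ saddlePoint (x : ℝ) ⌊Real.log (x : ℝ) ^ 100000⌋₊ * smoothZeta (saddlePoint (x : ℝ) ⌊Real.log (x : ℝ) ^ 100000⌋₊) ⌊Real.log (x : ℝ) ^ 100000⌋₊ /
              Real.sqrt (2 * Real.pi * saddlePhi₂ (saddlePoint (x : ℝ) ⌊Real.log (x : ℝ) ^ 100000⌋₊) ⌊Real.log (x : ℝ) ^ 100000⌋₊)))) / ((x : ℝ) / e₃) ≤
            (parityTernarySum ⌊Real.log (x : ℝ) ^ 100000⌋₊ 1 d₁ 1 ((x : ℝ) / e₁) ((x : ℝ) / e₂) ((x : ℝ) / e₃) c₁ c₂ c₃).re -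
              ∑ p ∈ (Finset.range (⌊Real.log (x : ℝ) ^ 100000⌋₊ + 1)).filter (fun p => p.Prime ∧ 3 ≤ p),
                (parityTernarySum ⌊Real.log (x : ℝ) ^ 100000⌋₊ 1 d₁ 1 ((x : ℝ) / e₁ / p) ((x : ℝ) / e₂ / p) ((x : ℝ) / e₃ / p) c₁ c₂ c₃).re)
    (hC : ∃ (c₁ c₂ c₃ : ℤ → ℂ) (c₀ : ℝ), 0 < c₀ ∧
        (∀ v : ℝ, (profileFn c₁ v).im = 0 ∧ 0 ≤ (profileFn c₁ v).re ∧ (profileFn c₁ v).re ≤ (if v ∈ Set.Ioc (1 / 2 : ℝ) 1 then 1 else 0)) ∧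
        (∀ v : ℝ, (profileFn c₂ v).im = 0 ∧ 0 ≤ (profileFn c₂ v).re ∧ (profileFn c₂ v).re ≤ (if v ∈ Set.Ioc (1 / 2 : ℝ) (3 / 4) then 1 else 0)) ∧
        (∀ v : ℝ, (profileFn c₃ v).im = 0 ∧ 0 ≤ (profileFn c₃ v).re ∧ (profileFn c₃ v).re ≤ 1) ∧
        ∀ N : ℕ, 1 ≤ N → ∀ᶠ x : ℕ in Filter.atTop, ∀ (e₁ e₂ e₃ d₁ : ℕ),
          (e₁ = 12 * 2 ^ N ∧ e₂ = 24 ∧ e₃ = 12 ∧ d₁ = 2 ^ N) →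
          c₀ * (((e₁ : ℝ) ^ (-saddlePoint (x : ℝ) ⌊Real.log (x : ℝ) ^ 100000⌋₊) *
            ((x : ℝ) ^ saddlePoint (x : ℝ) ⌊Real.log (x : ℝ) ^ 100000⌋₊ * smoothZeta (saddlePoint (x : ℝ) ⌊Real.log (x : ℝ) ^ 100000⌋₊) ⌊Real.log (x : ℝ) ^ 100000⌋₊ /
              Real.sqrt (2 * Real.pi * saddlePhi₂ (saddlePoint (x : ℝ) ⌊Real.log (x : ℝ) ^ 100000⌋₊) ⌊Real.log (x : ℝ) ^ 100000⌋₊))) *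
            ((e₂ : ℝ) ^ (-saddlePoint (x : ℝ) ⌊Real.log (x : ℝ) ^ 100000⌋₊) *
            ((x : ℝ) ^ saddlePoint (x : ℝ) ⌊Real.log (x : ℝ) ^ 100000⌋₊ * smoothZeta (saddlePoint (x : ℝ) ⌊Real.log (x : ℝ) ^ 100000⌋₊) ⌊Real.log (x : ℝ) ^ 100000⌋₊ /
              Real.sqrt (2 * Real.pi * saddlePhi₂ (saddlePoint (x : ℝ) ⌊Real.log (x : ℝ) ^ 100000⌋₊) ⌊Real.log (x : ℝ) ^ 100000⌋₊))) *
            ((e₃ : ℝ) ^ (-saddlePoint (x : ℝ) ⌊Real.log (x : ℝ) ^ 100000⌋₊) *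
            ((x : ℝ) ^ saddlePoint (x : ℝ) ⌊Real.log (x : ℝ) ^ 100000⌋₊ * smoothZeta (saddlePoint (x : ℝ) ⌊Real.log (x : ℝ) ^ 100000⌋₊) ⌊Real.log (x : ℝ) ^ 100000⌋₊ /
              Real.sqrt (2 * Real.pi * saddlePhi₂ (saddlePoint (x : ℝ) ⌊Real.log (x : ℝ) ^ 100000⌋₊) ⌊Real.log (x : ℝ) ^ 100000⌋₊)))) / ((x : ℝ) / e₃) ≤
            (parityTernarySum ⌊Real.log (x : ℝ) ^ 100000⌋₊ (-1) d₁ 1 ((x : ℝ) / e₁) ((x : ℝ) / e₂) ((x : ℝ) / e₃) c₁ c₂ c₃).re -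
              ∑ p ∈ (Finset.range (⌊Real.log (x : ℝ) ^ 100000⌋₊ + 1)).filter (fun p => p.Prime ∧ 3 ≤ p),
                (parityTernarySum ⌊Real.log (x : ℝ) ^ 100000⌋₊ (-1) d₁ 1 ((x : ℝ) / e₁ / p) ((x : ℝ) / e₂ / p) ((x : ℝ) / e₃ / p) c₁ c₂ c₃).re) :
    FamilySize := by
  intro N hN
  obtain ⟨a₁, a₂, a₃, cA, hcA, hpa₁, hpa₂, hpa₃, hAev⟩ := hA
  obtain ⟨b₁, b₂, b₃, cC, hcC, hpb₁, hpb₂, hpb₃, hCev⟩ := hC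
  obtain ⟨x₁, hx₁⟩ := eventually_atTop.1 (hAev N hN)
  obtain ⟨x₂, hx₂⟩ := eventually_atTop.1 (hCev N hN)
  obtain ⟨x₃, hx₃⟩ := eventually_atTop.1 regime_eventually
  clear hAev hCev
  refine ⟨min cA cC / (10 ^ 6 * (2 ^ N * 2 ^ N)), div_pos (lt_min hcA hcC) (by positivity),
    x₁ + x₂ + ⌈x₃⌉₊, fun M hM F hF => ?_⟩
  -- the master scale as a natural number, and the thresholds
  have hMx : M ≤ 48 * 2 ^ N * M := Nat.le_mul_of_pos_left M (by positivity)
  have hAx := hx₁ (48 * 2 ^ N * M) (by omega)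
  have hCx := hx₂ (48 * 2 ^ N * M) (by omega)
  clear hx₁ hx₂
  have h2N : (1 : ℝ) ≤ 2 ^ N := one_le_pow₀ (by norm_num)
  have hsq : (2 : ℝ) ^ N ≤ 2 ^ N * 2 ^ N := le_mul_of_one_le_right (by positivity) h2N
  have hxc : ((48 * 2 ^ N * M : ℕ) : ℝ) = masterScale N M := by
    push_cast [masterScale]
    ring
  have hMle : (M : ℝ) ≤ masterScale N M := by
    unfold masterScale
    nlinarith [(Nat.cast_nonneg M : (0 : ℝ) ≤ M)]
  have hge : x₃ ≤ masterScale N M := by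
    have h1 : (⌈x₃⌉₊ : ℝ) ≤ M := by exact_mod_cast (by omega : ⌈x₃⌉₊ ≤ M)
    exact (Nat.le_ceil x₃).trans (h1.trans hMle)
  have hYdef : ⌊Real.log (masterScale N M) ^ 100000⌋₊ = levelOf N M := rfl
  have hR := hx₃ (masterScale N M) hge
  clear hx₃
  rw [hYdef] at hR
  obtain ⟨hx1, hy2, hα1, hK0, hΨ⟩ := hR
  have hx0 : 0 < masterScale N M := by linarith
  -- numeric facts for the four configurations
  have heA : (1 : ℝ) ≤ 24 * 2 ^ N := by linarith
  have heC : (1 : ℝ) ≤ 12 * 2 ^ N := by linarith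
  have heG : (1 : ℝ) ≤ 6 * 2 ^ N := by linarith
  have hPA : (729 : ℝ) * (24 * 2 ^ N * 24) ≤ 10 ^ 6 * (2 ^ N * 2 ^ N) := by linarith
  have hPG : (729 : ℝ) * (48 * 24) ≤ 10 ^ 6 * (2 ^ N * 2 ^ N) := by linarith
  have hPG' : (729 : ℝ) * (24 * 2 ^ N * (12 * 2 ^ N)) ≤ 10 ^ 6 * (2 ^ N * 2 ^ N) := by nlinarith
  have hPC : (729 : ℝ) * (12 * 2 ^ N * 24) ≤ 10 ^ 6 * (2 ^ N * 2 ^ N) := by linarith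
  have hm0 : 0 ≤ min cA cC := le_min hcA.le hcC.le
  have hmA : min cA cC ≤ cA := min_le_left _ _
  have hmC : min cA cC ≤ cC := min_le_right _ _
  -- the scales `x / e` of the four configurations
  have hNp : (2 : ℝ) ^ N = 2 * 2 ^ (N - 1) := by
    rw [← pow_succ', Nat.sub_add_cancel hN]
  have s1 : masterScale N M / (24 * 2 ^ N) = 2 * (M : ℝ) := by
    rw [div_eq_iff (by positivity)]
    unfold masterScale
    ring
  have s2 : masterScale N M / 24 = 2 * (2 ^ N * (M : ℝ)) := by
    unfold masterScale
    ring
  have s3 : masterScale N M / 12 = 4 * (2 ^ N * (M : ℝ)) := by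
    unfold masterScale
    ring
  have u1 : masterScale N M / 48 = 2 * ((2 ^ (N - 1) * M : ℕ) : ℝ) := by
    unfold masterScale
    push_cast
    rw [hNp]
    ring
  have u2 : masterScale N M / 24 = 2 * (2 * ((2 ^ (N - 1) * M : ℕ) : ℝ)) := by
    unfold masterScale
    push_cast
    rw [hNp]
    ring
  have u3 : masterScale N M / 12 = 4 * (2 * ((2 ^ (N - 1) * M : ℕ) : ℝ)) := by
    unfold masterScale
    push_cast
    rw [hNp]
    ring
  have v2 : masterScale N M / (12 * 2 ^ N) = 2 * (2 * (M : ℝ)) := by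
    rw [div_eq_iff (by positivity)]
    unfold masterScale
    ring
  have v3 : masterScale N M / (6 * 2 ^ N) = 4 * (2 * (M : ℝ)) := by
    rw [div_eq_iff (by positivity)]
    unfold masterScale
    ring
  have w1 : masterScale N M / (12 * 2 ^ N) = 4 * (M : ℝ) := by
    rw [div_eq_iff (by positivity)]
    unfold masterScale
    ring
  -- the four sieved bounds at `x = 48 · 2^N · M`, brought to the Bonferroni scales
  have kA := hAx (24 * 2 ^ N) 24 12 (2 ^ N) (Or.inl ⟨rfl, rfl, rfl, rfl⟩)
  have kG := hAx 48 24 12 2 (Or.inr (Or.inl ⟨rfl, rfl, rfl, rfl⟩))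
  have kG' := hAx (24 * 2 ^ N) (12 * 2 ^ N) (6 * 2 ^ N) 2 (Or.inr (Or.inr ⟨rfl, rfl, rfl, rfl⟩))
  have kC := hCx (12 * 2 ^ N) 24 12 (2 ^ N) ⟨rfl, rfl, rfl, rfl⟩
  clear hAx hCx
  rw [hxc, hYdef] at kA kG kG' kC
  simp only [Nat.cast_mul, Nat.cast_pow, Nat.cast_ofNat] at kA kG kG' kC
  rw [s1, s2, s3] at kA
  rw [u1, u2, u3] at kG
  rw [s1, v2, v3] at kG'
  rw [w1, s2, s3] at kC
  -- the Bonferroni bounds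
  have bA := stub_cardFA_ge_bonferroni N M (levelOf N M) a₁ a₂ a₃ hy2 hpa₁ hpa₂ hpa₃
  have bG := stub_cardFA_ge_bonferroni 1 (2 ^ (N - 1) * M) (levelOf N M) a₁ a₂ a₃ hy2 hpa₁ hpa₂ hpa₃
  have bG' := stub_cardFA_ge_bonferroni 1 M (levelOf N M) a₁ a₂ a₃ hy2 hpa₁ hpa₂ hpa₃
  have bC := stub_cardFC_ge_bonferroni N M (levelOf N M) b₁ b₂ b₃ hy2 hpb₁ hpb₂ hpb₃
  simp only [pow_one] at bG bG'
  have fA : _ ≤ ((FAfam N M (levelOf N M)).card : ℝ) :=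
    card_ge_of_main (P := 10 ^ 6 * (2 ^ N * 2 ^ N)) hx0 hK0 (Nat.cast_nonneg _) hΨ hα1 heA (by norm_num)
      (by norm_num) hm0 hmA hPA s3.symm (kA.trans bA)
  have fG : _ ≤ ((FAfam 1 (2 ^ (N - 1) * M) (levelOf N M)).card : ℝ) :=
    card_ge_of_main (P := 10 ^ 6 * (2 ^ N * 2 ^ N)) hx0 hK0 (Nat.cast_nonneg _) hΨ hα1 (by norm_num)
      (by norm_num) (by norm_num) hm0 hmA hPG u3.symm (kG.trans bG)
  have fG' : _ ≤ ((FAfam 1 M (levelOf N M)).card : ℝ) :=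
    card_ge_of_main (P := 10 ^ 6 * (2 ^ N * 2 ^ N)) hx0 hK0 (Nat.cast_nonneg _) hΨ hα1 heA heC heG hm0 hmA
      hPG' v3.symm (kG'.trans bG')
  have fC : _ ≤ ((FCfam N M (levelOf N M)).card : ℝ) :=
    card_ge_of_main (P := 10 ^ 6 * (2 ^ N * 2 ^ N)) hx0 hK0 (Nat.cast_nonneg _) hΨ hα1 heC (by norm_num)
      (by norm_num) hm0 hmC hPC s3.symm (kC.trans bC)
  rcases hF with rfl | rfl | rfl | rfl | rfl
  · exact fA
  · show _ ≤ ((famFB N M).card : ℝ)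
    unfold famFB
    rw [card_FBfam]
    exact fA
  · exact fC
  · exact fG
  · exact fG'

end Summit.ABC.ABC.Theorems.TameLocalReceptacle

end
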